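/-
Origin: expansion seat `planner-pub-hodgecm-pv08-g2-0`, handover v2 2026-08-18 (`HOME/pub-hodgecm-pv08-g2/lean/Pv08g2/S5ConservativeQaut.lean`, md5 5c83b691, 453 lines);
landed by the gen-6 packager in gate run 22 as `HodgeCM/PerL34/S5ConservativeQaut.lean` (import ^import Pv[0-9]+g[0-9]+\.PerL34\.→import HodgeCM.PerL34. ×1).
-/
/-
Origin: HOME/pub-hodgecm-pv08-g2/lean/Pv08g2/S5ConservativeQaut.lean — session planner-pub-hodgecm-pv08-g2-0 (unit
pub-hodgecm-pv08-g2, DAG-NODE PROVER #08 gen 2; seam S5 node-owner audit, `N19g_core` half).  Intended final place: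
`HodgeCM/PerL34/S5ConservativeQaut.lean`, after pv02-g2's `HodgeCM/PerL34/QautDictionary.lean` (imported here through
the byte-identical vendored copy `Pv02g2/PerL34/QautDictionary.lean`, see `VENDORED.md`; the packager rewrites the
import).  KERNEL, nothing cited, nothing asserted: a CONSERVATIVITY WITNESS for the `N19g_core` half of seam S5.
-/
import Mathlib
import Summits.HodgeConjecture.HodgeCM.PerL34.QautDictionary

/-!
# Seam S5, `N19g_core` half — the Qaut bridge record is CONSERVATIVE over the leaf

pv02-g2's `QautDictionary.QautBridge T V c D k l` packages the archimedean `(𝔤,K)`-shell of tex ll. 355–372 together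
with the D2/D4/D5 dictionary, and `QautDictionary.N19g_core_of_bridge` shows `QautBridge → N19g_core`.  This file
shows the converse direction `N19g_core → Nonempty QautBridge` by an honest-to-kernel JUNK INSTANCE, hence

  `Nonempty (QautBridge T V c D k l) ↔ N19g_core T V c D k l`      (`nonempty_qautBridge_iff`).

READING (node-owner audit, pv08 = owner of N19): the bridge record asks for NOTHING beyond the leaf `N19g_core` in
logical strength — it is a re-packaging of the leaf through pv02's kernel theorem `Qaut.pr_mul` (the converse of
(eq:Qaut) on generators), not a hidden strengthening; its mathematical content is entirely in the LABELS of its fields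
(which the true lattice model must instantiate), exactly as for the `(12)`-half (`S5Conservative.lean`).

The junk shell: `K = S¹ × D₄` (circle times the dihedral group of order 8, discrete), `μ = Haar ⊗ uniform`,
`ρ (z, f) = z • ρ_F f` with `ρ_F` the standard reflection representation of `D₄` in the eigenbasis of the rotation
(`r i ↦ diag (I^i, I^{-i})`, `sr i ↦ antidiag`), `k₀ = (e^{2πi√2}, 1)` (so `ξ = e^{2πi√2}` has infinite order),
`C = C(K, Idx →ᵇ ℂ)` (continuous functions on `K` with values in the bounded functions on the discrete index set `Idx`
of the wedge-set), `σ` = right translation, one form `u_a` per wedge-set element `a` and one common form `v`, and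
`toHG` = (evaluation at `1 ∈ K`) followed by a linear extension of `indicator a ↦ a`.  The decomposition field is
discharged by `Qaut.pr_mul`: `pr (u_a (e 0) · v (e 1)) = ½ • (u_a ∧ v)`.
-/

set_option autoImplicit false

noncomputable section

open MeasureTheory Matrix Complex
open scoped NNReal ENNReal
open HodgeCM.Prior.Perl34File
open HodgeCM.PerL34.Qaut

namespace HodgeCM
namespace PerL34
namespace S5ConservativeQaut

/-! ## 1. The finite factor `D₄` and its reflection representation -/

/-- the dihedral group of order `8`. -/
abbrev D4 : Type := DihedralGroup 4

/-- the discrete topology on `D₄` — a LOCAL instance: this file puts no global data instance on Mathlib's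
`DihedralGroup 4` or `Circle`; the bridge record stores the instances it uses as explicit fields. -/
@[reducible] def topD4 : TopologicalSpace D4 := ⊥
attribute [local instance] topD4
/-- (Ported verbatim from the HodgeCMPerL package; no docstring in the source.) -/
instance discreteD4 : DiscreteTopology D4 := ⟨rfl⟩
/-- the discrete σ-algebra on `D₄` (LOCAL instance). -/
@[reducible] def measD4 : MeasurableSpace D4 := ⊤
attribute [local instance] measD4
/-- (Ported verbatim from the HodgeCMPerL package; no docstring in the source.) -/
instance measurableSingletonD4 : MeasurableSingletonClass D4 := ⟨fun _ => MeasurableSpace.measurableSet_top⟩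
/-- (Ported verbatim from the HodgeCMPerL package; no docstring in the source.) -/
instance borelD4 : BorelSpace D4 := ⟨borel_eq_top_of_discrete.symm⟩

/-- `χ i = I ^ i` on `ZMod 4`. -/
def χ (i : ZMod 4) : ℂ := I ^ i.val

/-- (Ported verbatim from the HodgeCMPerL package; no docstring in the source.) -/
theorem I_pow_mod_four (m : ℕ) : I ^ (m % 4) = I ^ m := by
  conv_rhs => rw [← Nat.mod_add_div m 4, pow_add, pow_mul, Complex.I_pow_four, one_pow, mul_one]

/-- (Ported verbatim from the HodgeCMPerL package; no docstring in the source.) -/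
theorem χ_add (i j : ZMod 4) : χ (i + j) = χ i * χ j := by
  unfold χ
  rw [ZMod.val_add, I_pow_mod_four, pow_add]

/-- (Ported verbatim from the HodgeCMPerL package; no docstring in the source.) -/
theorem χ_zero : χ 0 = 1 := by simp [χ]

/-- (Ported verbatim from the HodgeCMPerL package; no docstring in the source.) -/
theorem χ_mul_χ_neg (i : ZMod 4) : χ i * χ (-i) = 1 := by
  rw [← χ_add, add_neg_cancel, χ_zero]

/-- (Ported verbatim from the HodgeCMPerL package; no docstring in the source.) -/
theorem χ_neg_mul_χ (i : ZMod 4) : χ (-i) * χ i = 1 := by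
  rw [mul_comm, χ_mul_χ_neg]

/-- (Ported verbatim from the HodgeCMPerL package; no docstring in the source.) -/
theorem χ_one : χ 1 = I := by
  simp [χ, show (1 : ZMod 4).val = 1 from rfl]

/-- (Ported verbatim from the HodgeCMPerL package; no docstring in the source.) -/
theorem χ_neg_one : χ (-1) = -I := by
  have h : (-1 : ZMod 4).val = 3 := by decide
  rw [χ, h, pow_succ, I_sq]; ring

/-- the reflection representation of `D₄` in the eigenbasis of the rotation. -/
def ρFfun : D4 → Matrix (Fin 2) (Fin 2) ℂ
  | DihedralGroup.r i => !![χ i, 0; 0, χ (-i)]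
  | DihedralGroup.sr i => !![0, χ (-i); χ i, 0]

/-- (Ported verbatim from the HodgeCMPerL package; no docstring in the source.) -/
theorem ρFfun_mul (a b : D4) : ρFfun (a * b) = ρFfun a * ρFfun b := by
  rcases a with i | i <;> rcases b with j | j
  · simp only [DihedralGroup.r_mul_r, ρFfun]
    ext p q; fin_cases p <;> fin_cases q <;> simp [Matrix.mul_apply, Fin.sum_univ_two, χ_add, mul_comm]
  · simp only [DihedralGroup.r_mul_sr, ρFfun]
    ext p q; fin_cases p <;> fin_cases q <;>
      simp [Matrix.mul_apply, Fin.sum_univ_two, χ_add, sub_eq_add_neg, mul_comm]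
  · simp only [DihedralGroup.sr_mul_r, ρFfun]
    ext p q; fin_cases p <;> fin_cases q <;>
      simp [Matrix.mul_apply, Fin.sum_univ_two, χ_add, mul_comm]
  · simp only [DihedralGroup.sr_mul_sr, ρFfun]
    ext p q; fin_cases p <;> fin_cases q <;>
      simp [Matrix.mul_apply, Fin.sum_univ_two, χ_add, sub_eq_add_neg, mul_comm]

/-- the reflection representation as a homomorphism. -/
def ρF : D4 →* Matrix (Fin 2) (Fin 2) ℂ where
  toFun := ρFfun
  map_one' := by
    rw [DihedralGroup.one_def]
    simp only [ρFfun, neg_zero, χ_zero]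
    ext p q; fin_cases p <;> fin_cases q <;> simp
  map_mul' := ρFfun_mul

/-- (Ported verbatim from the HodgeCMPerL package; no docstring in the source.) -/
theorem det_ρF (a : D4) : (ρF a).det = 1 ∨ (ρF a).det = -1 := by
  rcases a with i | i
  · left; show (ρFfun _).det = 1
    simp only [ρFfun, Matrix.det_fin_two_of, χ_mul_χ_neg]; ring
  · right; show (ρFfun _).det = -1
    simp only [ρFfun, Matrix.det_fin_two_of, χ_neg_mul_χ]; ring

/-- (Ported verbatim from the HodgeCMPerL package; no docstring in the source.) -/
theorem det_ρF_ne_zero (a : D4) : (ρF a).det ≠ 0 := by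
  rcases det_ρF a with h | h <;> rw [h] <;> norm_num

/-! ## 2. The compact group `K = S¹ × D₄`, its Haar probability measure, and `ρ` -/

/-- the Borel σ-algebra on the circle (LOCAL instance; Mathlib fixes none, cf. `LocalFactors/SmokeCompact`). -/
@[reducible] def measCircle : MeasurableSpace Circle := borel Circle
attribute [local instance] measCircle
/-- (Ported verbatim from the HodgeCMPerL package; no docstring in the source.) -/
instance borelCircle : BorelSpace Circle := ⟨rfl⟩

/-- the junk `K_{ι₁}`. -/
abbrev K : Type := Circle × D4

/-- Haar probability measure on the circle. -/
def μC : Measure Circle := Measure.haarMeasure ⊤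

/-- (Ported verbatim from the HodgeCMPerL package; no docstring in the source.) -/
instance : IsProbabilityMeasure μC :=
  ⟨by rw [μC, ← TopologicalSpace.PositiveCompacts.coe_top]; exact Measure.haarMeasure_self⟩

/-- uniform probability measure on `D₄`. -/
def μD : Measure D4 := ((Fintype.card D4 : ℝ≥0)⁻¹) • Measure.count

/-- (Ported verbatim from the HodgeCMPerL package; no docstring in the source.) -/
instance : IsProbabilityMeasure μD := by
  constructor
  rw [μD, Measure.smul_apply, Measure.count_univ]
  simp only [ENat.card_eq_coe_fintype_card, ENat.toENNReal_coe]
  rw [ENNReal.smul_def, smul_eq_mul, ENNReal.coe_inv (by positivity), ENNReal.coe_natCast,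
    ENNReal.inv_mul_cancel (by positivity) (ENNReal.natCast_ne_top _)]

/-- the junk Haar probability measure on `K`. -/
def μ : Measure K := μC.prod μD

/-- (Ported verbatim from the HodgeCMPerL package; no docstring in the source.) -/
instance : IsProbabilityMeasure μ := by unfold μ; infer_instance
/-- (Ported verbatim from the HodgeCMPerL package; no docstring in the source.) -/
instance : μ.IsMulLeftInvariant := by unfold μ μC μD; infer_instance
/-- (Ported verbatim from the HodgeCMPerL package; no docstring in the source.) -/
instance : μ.IsMulRightInvariant := by unfold μ μC μD; infer_instance

/-- `ρ (z, f) = z • ρ_F f`. -/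
def ρ : K →* Matrix (Fin 2) (Fin 2) ℂ where
  toFun x := (x.1 : ℂ) • ρF x.2
  map_one' := by simp
  map_mul' x y := by
    rw [Prod.fst_mul, Prod.snd_mul, Circle.coe_mul, map_mul, smul_mul_smul_comm]

/-- (Ported verbatim from the HodgeCMPerL package; no docstring in the source.) -/
theorem ρ_apply (x : K) : ρ x = (x.1 : ℂ) • ρF x.2 := rfl

/-- (Ported verbatim from the HodgeCMPerL package; no docstring in the source.) -/
theorem ρ_cont : Continuous fun x => ρ x :=
  (continuous_subtype_val.comp continuous_fst).smul (continuous_of_discreteTopology.comp continuous_snd)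

/-- (Ported verbatim from the HodgeCMPerL package; no docstring in the source.) -/
theorem ρ_det (x : K) : IsUnit (ρ x).det := by
  rw [isUnit_iff_ne_zero, ρ_apply, Matrix.det_smul, Fintype.card_fin]
  exact mul_ne_zero (pow_ne_zero _ (Circle.coe_ne_zero x.1)) (det_ρF_ne_zero x.2)

/-- (Ported verbatim from the HodgeCMPerL package; no docstring in the source.) -/
theorem ρ_diag : ∃ x s t, s ≠ t ∧ ρ x = !![s, 0; 0, t] := by
  refine ⟨((1 : Circle), DihedralGroup.r 1), χ 1, χ (-1), ?_, ?_⟩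
  · rw [χ_one, χ_neg_one]
    intro h
    have := congrArg Complex.im h
    norm_num at this
  · rw [ρ_apply, Circle.coe_one, one_smul]; rfl

/-- (Ported verbatim from the HodgeCMPerL package; no docstring in the source.) -/
theorem ρ_antidiag : ∃ x a b, ρ x = !![0, a; b, 0] :=
  ⟨((1 : Circle), DihedralGroup.sr 0), χ (-0), χ 0, by rw [ρ_apply, Circle.coe_one, one_smul]; rfl⟩

/-- the central `U(1)`-element of infinite order. -/
def k₀ : K := (Circle.exp (2 * Real.pi * Real.sqrt 2), 1)

/-- its scalar `ξ = e^{2πi√2}`. -/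
def ξ : ℂ := (Circle.exp (2 * Real.pi * Real.sqrt 2) : ℂ)

/-- (Ported verbatim from the HodgeCMPerL package; no docstring in the source.) -/
theorem ρ_k₀ : ρ k₀ = ξ • (1 : Matrix (Fin 2) (Fin 2) ℂ) := by
  rw [ρ_apply, k₀, map_one]; rfl

/-- (Ported verbatim from the HodgeCMPerL package; no docstring in the source.) -/
theorem ξ_ne_zero : ξ ≠ 0 := Circle.coe_ne_zero _

/-- (Ported verbatim from the HodgeCMPerL package; no docstring in the source.) -/
theorem ξ_pow_ne_one (m : ℕ) (hm : 1 ≤ m) : ξ ^ m ≠ 1 := by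
  intro h
  rw [ξ, Circle.coe_exp, ← Complex.exp_nat_mul, Complex.exp_eq_one_iff] at h
  obtain ⟨n, hn⟩ := h
  have him := congrArg Complex.im hn
  simp only [mul_im, natCast_re, natCast_im, ofReal_re, ofReal_im, I_re, I_im, mul_re, intCast_re, intCast_im,
    re_ofNat, im_ofNat, mul_zero, mul_one, zero_mul, sub_zero, add_zero] at him
  -- him : ↑m * (2 * π * √2) = ↑n * (2 * π)
  have hpi : (0 : ℝ) < 2 * Real.pi := by positivity
  have hm' : (0 : ℝ) < m := by exact_mod_cast hm
  have h2 : Real.sqrt 2 = (n : ℝ) / (m : ℝ) := by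
    rw [eq_div_iff hm'.ne']
    nlinarith [him, hpi]
  exact irrational_sqrt_two.ne_rat ((n : ℚ) / (m : ℚ)) (by rw [h2]; push_cast; ring)

/-! ## 3. The algebra `C = C(K, Idx →ᵇ ℂ)`, right translation, and the forms -/

/-- a discrete copy of a set (the index set of the wedge-set). -/
structure Idx {X : Type*} (s : Set X) : Type _ where
  /-- the element -/
  val : X
  /-- its membership -/
  mem : val ∈ s

namespace Idx
variable {X : Type*} (s : Set X)
/-- (Ported verbatim from the HodgeCMPerL package; no docstring in the source.) -/
instance : TopologicalSpace (Idx s) := ⊥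
/-- (Ported verbatim from the HodgeCMPerL package; no docstring in the source.) -/
instance : DiscreteTopology (Idx s) := ⟨rfl⟩
end Idx

section Shell

variable {X : Type*} (s : Set X)

/-- the coefficient algebra: bounded functions on the discrete index set. -/
abbrev B : Type _ := BoundedContinuousFunction (Idx s) ℂ

/-- the junk Banach algebra `C = C(K, B)`. -/
abbrev C : Type _ := C(K, B s)

open Classical in
/-- the indicator of an index. -/
def ind (a : Idx s) : B s :=
  BoundedContinuousFunction.mkOfDiscrete (fun a' => if a' = a then (1 : ℂ) else 0) 2 (by
    intro x y
    rw [dist_eq_norm]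
    refine (norm_sub_le _ _).trans ?_
    have h1 : ∀ z : Idx s, ‖(if z = a then (1 : ℂ) else 0)‖ ≤ 1 := by
      intro z; split_ifs <;> simp
    linarith [h1 x, h1 y])

open Classical in
/-- (Ported verbatim from the HodgeCMPerL package; no docstring in the source.) -/
theorem ind_apply (a a' : Idx s) : ind s a a' = if a' = a then (1 : ℂ) else 0 := rfl

/-- (Ported verbatim from the HodgeCMPerL package; no docstring in the source.) -/
theorem linearIndependent_ind : LinearIndependent ℂ (ind s) := by
  classical
  rw [linearIndependent_iff']
  intro t g hg a ha
  have h := congrArg (fun f : B s => f a) hg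
  simp only [BoundedContinuousFunction.coe_sum, Finset.sum_apply, BoundedContinuousFunction.coe_smul,
    ind_apply, smul_eq_mul, mul_ite, mul_one, mul_zero, BoundedContinuousFunction.coe_zero,
    Pi.zero_apply, Finset.sum_ite_eq, if_pos ha] at h
  exact h

/-- right translation by `x` on `K`. -/
def tr (x : K) : C(K, K) := ⟨fun y => y * x, continuous_id.mul continuous_const⟩

/-- right translation on `C`, by algebra automorphisms. -/
def σ : K →* (C s →ₐ[ℂ] C s) where
  toFun x := ContinuousMap.compRightAlgHom ℂ (B s) (tr x)
  map_one' := by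
    apply AlgHom.ext; intro f; apply ContinuousMap.ext; intro y
    simp [tr]
  map_mul' x x' := by
    apply AlgHom.ext; intro f; apply ContinuousMap.ext; intro y
    simp [tr, mul_assoc]

/-- (Ported verbatim from the HodgeCMPerL package; no docstring in the source.) -/
theorem σ_apply (x : K) (f : C s) (y : K) : σ s x f y = f (y * x) := rfl

/-- (Ported verbatim from the HodgeCMPerL package; no docstring in the source.) -/
theorem tr_eq_curry : (tr : K → C(K, K)) =
    fun x => (ContinuousMap.curry ⟨fun p : K × K => p.2 * p.1, continuous_snd.mul continuous_fst⟩) x := by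
  funext x; apply ContinuousMap.ext; intro y; rfl

/-- (Ported verbatim from the HodgeCMPerL package; no docstring in the source.) -/
theorem σ_cont (f : C s) : Continuous fun x => σ s x f := by
  show Continuous fun x => f.comp (tr x)
  have h : Continuous (tr : K → C(K, K)) := by
    rw [tr_eq_curry]; exact ContinuousMap.continuous _
  exact f.continuous_postcomp.comp h

/-- the form with coefficient `w` reading the `i`-th coordinate: `x ↦ (y ↦ (ρ y x)_i • w)`. -/
def form (w : B s) (i : Fin 2) : (Fin 2 → ℂ) →ₗ[ℂ] C s where
  toFun x := ⟨fun y => ((ρ y *ᵥ x) i) • w,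
    ((continuous_apply i).comp (ρ_cont.matrix_mulVec continuous_const)).smul continuous_const⟩
  map_add' x x' := by ext y : 1; simp [Matrix.mulVec_add, add_smul]
  map_smul' r x := by ext y : 1; simp [Matrix.mulVec_smul, smul_smul]

/-- (Ported verbatim from the HodgeCMPerL package; no docstring in the source.) -/
theorem form_apply (w : B s) (i : Fin 2) (x : Fin 2 → ℂ) (y : K) : form s w i x y = ((ρ y *ᵥ x) i) • w := rfl

/-- (Ported verbatim from the HodgeCMPerL package; no docstring in the source.) -/
theorem isForm_form (w : B s) (i : Fin 2) : IsForm ρ (σ s) (form s w i) := by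
  intro x v
  apply ContinuousMap.ext; intro y
  rw [σ_apply, form_apply, form_apply, map_mul, ← Matrix.mulVec_mulVec]

/-- evaluation at `1 ∈ K`, linear. -/
def ev₁ : C s →ₗ[ℂ] B s where
  toFun f := f 1
  map_add' _ _ := rfl
  map_smul' _ _ := rfl

/-- (Ported verbatim from the HodgeCMPerL package; no docstring in the source.) -/
theorem wedge_form_one (a : Idx s) : ev₁ s (wedge (form s (ind s a) 0) (form s 1 1)) = ind s a := by
  show (wedge (form s (ind s a) 0) (form s 1 1)) 1 = ind s a
  rw [wedge, ContinuousMap.sub_apply, ContinuousMap.mul_apply, ContinuousMap.mul_apply, form_apply, form_apply,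
    form_apply, form_apply, map_one, Matrix.one_mulVec, Matrix.one_mulVec]
  simp [e]

end Shell

/-! ## 4. The junk bridge over the leaf `N19g_core` -/

section Bridge

variable {U : Universe} (T : U.ThetaModel)
variable {L : CMField} {ι₁ : L →+* ℂ} (V : HermSpace3 L ι₁) (c : SeesawCtx L)
variable (D : Perl34.TorusData (T.core V c)) (k l : Fin 4)

/-- the index set: a discrete copy of the wedge-set of the side. -/
abbrev WIdx : Type _ := Idx (T.wedgeSet V c k l)

/-- a linear map `B →ₗ HG` sending the indicator of `a` to `a` (linear extension from the independent indicators). -/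
theorem exists_toHG₀ : ∃ Φ : B (T.wedgeSet V c k l) →ₗ[ℂ] T.HG L ι₁ V, ∀ a, Φ (ind _ a) = a.val := by
  have hli := linearIndependent_ind (T.wedgeSet V c k l)
  let f₀ : Submodule.span ℂ (Set.range (ind (T.wedgeSet V c k l))) →ₗ[ℂ] T.HG L ι₁ V :=
    (Finsupp.linearCombination ℂ (fun a : WIdx T V c k l => a.val)) ∘ₗ hli.repr
  obtain ⟨Φ, hΦ⟩ := LinearMap.exists_extend f₀
  refine ⟨Φ, fun a => ?_⟩
  have hmem : ind _ a ∈ Submodule.span ℂ (Set.range (ind (T.wedgeSet V c k l))) :=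
    Submodule.subset_span (Set.mem_range_self a)
  have h := LinearMap.congr_fun hΦ ⟨ind _ a, hmem⟩
  simp only [LinearMap.coe_comp, Function.comp_apply, Submodule.subtype_apply] at h
  rw [h]
  show Finsupp.linearCombination ℂ (fun a : WIdx T V c k l => a.val) (hli.repr ⟨ind _ a, hmem⟩) = a.val
  rw [hli.repr_eq_single a ⟨ind _ a, hmem⟩ rfl, Finsupp.linearCombination_single, one_smul]

/-- the dictionary map `toHG = Φ ∘ ev₁`. -/
def toHG : C (T.wedgeSet V c k l) →ₗ[ℂ] T.HG L ι₁ V :=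
  (exists_toHG₀ T V c k l).choose ∘ₗ ev₁ _

/-- (Ported verbatim from the HodgeCMPerL package; no docstring in the source.) -/
theorem toHG_wedge (a : WIdx T V c k l) :
    toHG T V c k l (wedge (form _ (ind _ a) 0) (form _ 1 1)) = a.val := by
  rw [toHG, LinearMap.comp_apply, wedge_form_one]
  exact (exists_toHG₀ T V c k l).choose_spec a


-- port_pkg: scope closed for this part
end Bridge
end S5ConservativeQaut
end PerL34
end HodgeCM
end
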